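import Mathlib
import Summits.ValiantsHypothesis.ValiantsHypothesis.Theorems.LacunarySymmetroidMatrixDescartesInertiaWindow

/-!
# `MatrixDescartes` (stmt-ValiantsHypothesis-18050) — INERTIA KIT, IV-e: END INERTIAS — for small `x > 0` the evaluated pencil
# `F(x) = ∑ₖ x^{dₖ}Sₖ` has the inertia of its LOWEST letter and for large `x` that of its HIGHEST letter (unique extreme exponents,
# non-singular extreme letters), for every real symmetric lacunary pencil at every format

HONEST FRAMING.  Cell `pub-symmetroid`, seat `val-sym-mdr-p2` (gen 17); helper file `--supports` the crux
`Theses.LacunarySymmetroid.MatrixDescartes`, NO closure claim.  General bookkeeping feeding the GLOBAL INDEX FORMULA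
(`…InertiaGlobalIndex`); nothing here bears on the crux in its window, on `stub_twoSided`, on `DoorA26`/`DoorA34`, registers, or
`VP ≠ VNP`.

CONTENT.  `negIndex_congr` / `posIndex_congr` (transport along matrix equalities), `negIndex_smul_pos` / `posIndex_smul_pos`
(`ν(cA) = ν(A)`, `π(cA) = π(A)` for `c > 0`, by Sylvester in family language), `rescaled_at_zero` (`∑ 0^{dₗ − d_{l₀}}Sₗ = S_{l₀}`),
END INERTIA LAWS `eventually_nhdsGT_zero_indices_eq` (for small `x > 0`: `ν(F(x)) = ν(S_{l₀})`, `π(F(x)) = π(S_{l₀})`, `F(x)`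
non-singular — the family `x^{−d_{l₀}}F(x)` extends continuously to `x = 0` with the non-singular value `S_{l₀}`, so g16's local
constancy `Inertia.eventually_negIndex_eq` applies at `0`) and `eventually_atTop_indices_eq` (for large `x`: `ν(F(x)) = ν(S_{l₁})`,
through the reflected family `y ↦ ∑ y^{d_{l₁} − dₗ}Sₗ` at `y = 1/x → 0⁺`). [folklore]; axioms standard; no definitions.
-/

-- layout Summits/ValiantsHypothesis/ValiantsHypothesis forces the duplicated namespace component
set_option linter.dupNamespace false

namespace Summit.ValiantsHypothesis.ValiantsHypothesis.Theorems.LacunarySymmetroidMatrixDescartes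

open Matrix Finset Polynomial
open scoped BigOperators Topology

namespace Inertia

variable {ι : Type} [Fintype ι] [DecidableEq ι]

/-! ## §1 End inertias -/

/-- Transport of the negative index along an equality of matrices. [folklore] -/
theorem negIndex_congr {A B : Matrix ι ι ℝ} (hA : A.IsHermitian) (hB : B.IsHermitian) (h : A = B) :
    Fintype.card {j // hA.eigenvalues j < 0} = Fintype.card {j // hB.eigenvalues j < 0} := by
  subst h
  rfl

/-- Transport of the positive index along an equality of matrices. [folklore] -/
theorem posIndex_congr {A B : Matrix ι ι ℝ} (hA : A.IsHermitian) (hB : B.IsHermitian) (h : A = B) :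
    Fintype.card {j // 0 < hA.eigenvalues j} = Fintype.card {j // 0 < hB.eigenvalues j} := by
  subst h
  rfl

/-- **Positive scaling preserves the negative index**: `ν(c • A) = ν(A)` for `c > 0`. [folklore] -/
theorem negIndex_smul_pos {A : Matrix ι ι ℝ} (hA : A.IsHermitian) {c : ℝ} (hc : 0 < c) (hcA : (c • A).IsHermitian) :
    Fintype.card {j // hcA.eigenvalues j < 0} = Fintype.card {j // hA.eigenvalues j < 0} := by
  refine le_antisymm ?_ ?_
  · refine card_le_negIndex hA (fun i : {j // hcA.eigenvalues j < 0} => (hcA.eigenvectorBasis i.1).ofLp) fun e he => ?_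
    have h := neg_eigenFamily hcA e he
    rw [Matrix.smul_mulVec, dotProduct_smul, smul_eq_mul] at h
    exact (mul_neg_iff.1 h).resolve_right (fun h' => absurd hc (not_lt.2 h'.1.le)) |>.2
  · refine card_le_negIndex hcA (fun i : {j // hA.eigenvalues j < 0} => (hA.eigenvectorBasis i.1).ofLp) fun e he => ?_
    have h := neg_eigenFamily hA e he
    rw [Matrix.smul_mulVec, dotProduct_smul, smul_eq_mul]
    exact mul_neg_of_pos_of_neg hc h

/-- **Positive scaling preserves the positive index.** [folklore] -/
theorem posIndex_smul_pos {A : Matrix ι ι ℝ} (hA : A.IsHermitian) {c : ℝ} (hc : 0 < c) (hcA : (c • A).IsHermitian) :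
    Fintype.card {j // 0 < hcA.eigenvalues j} = Fintype.card {j // 0 < hA.eigenvalues j} := by
  refine le_antisymm ?_ ?_
  · refine card_le_posIndex hA (fun i : {j // 0 < hcA.eigenvalues j} => (hcA.eigenvectorBasis i.1).ofLp) fun e he => ?_
    have h := pos_eigenFamily hcA e he
    rw [Matrix.smul_mulVec, dotProduct_smul, smul_eq_mul] at h
    exact pos_of_mul_pos_right h hc.le
  · refine card_le_posIndex hcA (fun i : {j // 0 < hA.eigenvalues j} => (hA.eigenvectorBasis i.1).ofLp) fun e he => ?_
    have h := pos_eigenFamily hA e he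
    rw [Matrix.smul_mulVec, dotProduct_smul, smul_eq_mul]
    exact mul_pos hc h

section Pencil

variable {κ : Type} [Fintype κ]

omit [Fintype ι] [DecidableEq ι] in
/-- The rescaled family at the origin is the lowest letter: `∑ₗ 0^{dₗ − d_{l₀}} Sₗ = S_{l₀}` when `d_{l₀}` is the unique minimum.
[folklore] -/
theorem rescaled_at_zero (d : κ → ℕ) (S : κ → Matrix ι ι ℝ) (l₀ : κ) (hmin : ∀ l, l ≠ l₀ → d l₀ < d l) :
    (∑ l, (0 : ℝ) ^ (d l - d l₀) • S l) = S l₀ := by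
  rw [Finset.sum_eq_single l₀]
  · simp
  · intro l _ hl
    have : d l - d l₀ ≠ 0 := by have := hmin l hl; omega
    rw [zero_pow this, zero_smul]
  · intro h; exact absurd (Finset.mem_univ l₀) h

/-- **END INERTIA LAW at `0⁺`.**  If `d_{l₀}` is the unique smallest exponent and `S_{l₀}` is non-singular, then for all small
`x > 0`: `ν(F(x)) = ν(S_{l₀})`, `π(F(x)) = π(S_{l₀})`, and `F(x)` is non-singular. [folklore] -/
theorem eventually_nhdsGT_zero_indices_eq (d : κ → ℕ) (S : κ → Matrix ι ι ℝ) (hS : ∀ k, (S k).IsSymm) (l₀ : κ)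
    (hmin : ∀ l, l ≠ l₀ → d l₀ < d l) (hdet : (S l₀).det ≠ 0) :
    ∀ᶠ x in 𝓝[>] (0 : ℝ),
      Fintype.card {j // (isHermitian_pencil d S hS x).eigenvalues j < 0}
          = Fintype.card {j // (isHermitian_of_isSymm (hS l₀)).eigenvalues j < 0} ∧
      Fintype.card {j // 0 < (isHermitian_pencil d S hS x).eigenvalues j}
          = Fintype.card {j // 0 < (isHermitian_of_isSymm (hS l₀)).eigenvalues j} ∧
      (∑ k, x ^ d k • S k).det ≠ 0 := by
  classical
  -- the rescaled family `H(x) = ∑ x^{dₗ − d_{l₀}} Sₗ`, continuous on `ℝ`, with `H(0) = S_{l₀}`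
  set e : κ → ℕ := fun l => d l - d l₀ with he
  have hH0 : (∑ k, (0 : ℝ) ^ e k • S k) = S l₀ := rescaled_at_zero d S l₀ hmin
  have hHdet : (∑ k, (0 : ℝ) ^ e k • S k).det ≠ 0 := by rw [hH0]; exact hdet
  have hν := eventually_negIndex_eq (fun x => ∑ k, x ^ e k • S k) (continuous_pencil_entry e S) (isHermitian_pencil e S hS)
    0 hHdet
  -- the determinant stays non-zero near `0`
  have hdetc : Continuous fun x : ℝ => (∑ k, x ^ e k • S k).det :=
    Continuous.matrix_det (continuous_pi fun i => continuous_pi fun j => continuous_pencil_entry e S i j)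
  have hne := (hdetc.continuousAt (x := 0)).eventually_ne hHdet
  have hpos : ∀ᶠ x in 𝓝[>] (0 : ℝ), 0 < x := eventually_nhdsWithin_of_forall fun x hx => hx
  refine (((hν.and hne).filter_mono nhdsWithin_le_nhds).and hpos).mono fun x hx => ?_
  obtain ⟨⟨hνx, hnex⟩, hx⟩ := hx
  -- `F(x) = x^{d_{l₀}} • H(x)` for `x > 0`
  have hscale : (∑ k, x ^ d k • S k) = x ^ d l₀ • ∑ k, x ^ e k • S k := by
    rw [Finset.smul_sum]
    refine Finset.sum_congr rfl fun k _ => ?_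
    rw [smul_smul, ← pow_add]
    congr 2
    by_cases hk : k = l₀
    · rw [hk, he]; simp
    · have := hmin k hk; rw [he]; dsimp only; omega
  have hc : 0 < x ^ d l₀ := pow_pos hx _
  have hHx : (∑ k, x ^ e k • S k).IsHermitian := isHermitian_pencil e S hS x
  have hcH : (x ^ d l₀ • ∑ k, x ^ e k • S k).IsHermitian := by rw [← hscale]; exact isHermitian_pencil d S hS x
  have h1 : Fintype.card {j // (isHermitian_pencil d S hS x).eigenvalues j < 0} = Fintype.card {j // hHx.eigenvalues j < 0} := by
    rw [negIndex_congr (isHermitian_pencil d S hS x) hcH hscale, negIndex_smul_pos hHx hc hcH]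
  have h2 : Fintype.card {j // 0 < (isHermitian_pencil d S hS x).eigenvalues j} = Fintype.card {j // 0 < hHx.eigenvalues j} := by
    rw [posIndex_congr (isHermitian_pencil d S hS x) hcH hscale, posIndex_smul_pos hHx hc hcH]
  have hdetx : (∑ k, x ^ d k • S k).det ≠ 0 := by
    rw [hscale, Matrix.det_smul]
    exact mul_ne_zero (pow_ne_zero _ hc.ne') hnex
  -- indices of `H(x)` = indices of `H(0) = S_{l₀}` (ν by local constancy, π through the count)
  have hν0 : Fintype.card {j // hHx.eigenvalues j < 0} = Fintype.card {j // (isHermitian_of_isSymm (hS l₀)).eigenvalues j < 0} := by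
    rw [hνx]; exact negIndex_congr _ _ hH0
  have hπ0 : Fintype.card {j // 0 < hHx.eigenvalues j} = Fintype.card {j // 0 < (isHermitian_of_isSymm (hS l₀)).eigenvalues j} := by
    have c1 := negIndex_add_posIndex_add_corank hHx
    have c2 := negIndex_add_posIndex_add_corank (isHermitian_of_isSymm (hS l₀))
    rw [corank_eq_zero_of_det_ne_zero hnex] at c1
    rw [corank_eq_zero_of_det_ne_zero hdet] at c2
    omega
  exact ⟨h1.trans hν0, h2.trans hπ0, hdetx⟩

/-- **END INERTIA LAW at `+∞`.**  If `d_{l₁}` is the unique largest exponent and `S_{l₁}` is non-singular, then for all large `x`: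
`ν(F(x)) = ν(S_{l₁})`, `π(F(x)) = π(S_{l₁})`, and `F(x)` is non-singular. [folklore] -/
theorem eventually_atTop_indices_eq (d : κ → ℕ) (S : κ → Matrix ι ι ℝ) (hS : ∀ k, (S k).IsSymm) (l₁ : κ)
    (hmax : ∀ l, l ≠ l₁ → d l < d l₁) (hdet : (S l₁).det ≠ 0) :
    ∀ᶠ x in Filter.atTop,
      Fintype.card {j // (isHermitian_pencil d S hS x).eigenvalues j < 0}
          = Fintype.card {j // (isHermitian_of_isSymm (hS l₁)).eigenvalues j < 0} ∧
      Fintype.card {j // 0 < (isHermitian_pencil d S hS x).eigenvalues j}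
          = Fintype.card {j // 0 < (isHermitian_of_isSymm (hS l₁)).eigenvalues j} ∧
      (∑ k, x ^ d k • S k).det ≠ 0 := by
  classical
  -- the reflected family `H(y) = ∑ y^{d_{l₁} − dₗ} Sₗ`, `F(x) = x^{d_{l₁}} H(1/x)`
  set e : κ → ℕ := fun l => d l₁ - d l with he
  have hmin : ∀ l, l ≠ l₁ → e l₁ < e l := by intro l hl; have := hmax l hl; rw [he]; dsimp only; omega
  have hH0 : (∑ k, (0 : ℝ) ^ (e k - e l₁) • S k) = S l₁ := rescaled_at_zero e S l₁ hmin
  have he0 : e l₁ = 0 := by rw [he]; simp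
  have hH := eventually_nhdsGT_zero_indices_eq e S hS l₁ hmin hdet
  have ht : Filter.Tendsto (fun x : ℝ => x⁻¹) Filter.atTop (𝓝[>] (0 : ℝ)) := tendsto_inv_atTop_nhdsGT_zero
  refine ((ht.eventually hH).and (Filter.eventually_gt_atTop 0)).mono fun x hx => ?_
  obtain ⟨⟨h1, h2, h3⟩, hx⟩ := hx
  have hscale : (∑ k, x ^ d k • S k) = x ^ d l₁ • ∑ k, x⁻¹ ^ e k • S k := by
    rw [Finset.smul_sum]
    refine Finset.sum_congr rfl fun k _ => ?_
    rw [smul_smul]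
    congr 1
    have hle : d k ≤ d l₁ := by
      by_cases hk : k = l₁
      · rw [hk]
      · exact (hmax k hk).le
    have hsplit : x ^ d l₁ = x ^ d k * x ^ e k := by rw [← pow_add]; congr 1; rw [he]; dsimp only; omega
    rw [hsplit, mul_assoc, ← mul_pow, mul_inv_cancel₀ hx.ne', one_pow, mul_one]
  have hc : 0 < x ^ d l₁ := pow_pos hx _
  have hHx : (∑ k, x⁻¹ ^ e k • S k).IsHermitian := isHermitian_pencil e S hS x⁻¹
  have hcH : (x ^ d l₁ • ∑ k, x⁻¹ ^ e k • S k).IsHermitian := by rw [← hscale]; exact isHermitian_pencil d S hS x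
  refine ⟨?_, ?_, ?_⟩
  · rw [negIndex_congr (isHermitian_pencil d S hS x) hcH hscale, negIndex_smul_pos hHx hc hcH]
    exact h1
  · rw [posIndex_congr (isHermitian_pencil d S hS x) hcH hscale, posIndex_smul_pos hHx hc hcH]
    exact h2
  · rw [hscale, Matrix.det_smul]
    exact mul_ne_zero (pow_ne_zero _ hc.ne') h3

end Pencil

end Inertia

end Summit.ValiantsHypothesis.ValiantsHypothesis.Theorems.LacunarySymmetroidMatrixDescartes
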